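import Mathlib
import HarnessLib

/-!
# Regular parameters ascend along a formally unramified extension: the maximal ideal of `S_q` is generated by the generators of `q ∩ R`

Route `RadicialJung`, crux `CleanModels` (stmt-ResolutionOfSingularities-15917), line `Sketch` rev 35; explicit-unit seat `decomp-res-hand-1` g3.
GROUNDWORK (step 5, étale half, of the recipe in `Cruxes/CleanModels/Lines/Sketch-memo-hand1-g3.md` §7) for the discharge of the printed input
`Literature.AlgebraicGeometry.Resolution.KnafKuhlmann2005_Thm11_monomialForm` (Knaf–Kuhlmann 2005, Thm. 1.1 WITH its monomial clause): in
Knaf–Kuhlmann's §5 (p. 12: "the extension `𝒪_F|𝒪_E` is local-étale ([Ray], Ch. X, Thm. 1): `𝒪_F = A_q` for an étale `𝒪_E`-algebra `A`") the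
local ring of the standard-étale model `C = B[η]_{g(η)}` at the centre `q` has the SAME regular system of parameters as the toric local ring
`B_{q ∩ B}` — the Perron variables `x'` (toric half: ✓ `KK05ValueBasis.valuation_lt_one_iff_exists_sum`, p794087).  This file is the abstract
commutative-algebra step, over Mathlib's unramified API (`Algebra.isUnramifiedAt_iff_map_eq`, Stacks 00UW/02FM):

* `map_under_eq_maximalIdeal_of_formallyUnramified` — `R → S` essentially of finite type and formally unramified, `q ⊂ S` prime:
  `(q ∩ R) · S_q = 𝔪_{S_q}`.
* `maximalIdeal_eq_span_of_formallyUnramified` — if moreover `q ∩ R` is generated by `a₁,…,a_n ∈ R`, then `𝔪_{S_q}` is generated by their images.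

OURS (bookkeeping over Mathlib); proves nothing about resolution of singularities in characteristic `p`. counted 0.
-/

noncomputable section

set_option linter.dupNamespace false -- mandated namespace of this single-conjunct summit

open IsLocalRing

namespace Summit.ResolutionOfSingularities.ResolutionOfSingularities.Theorems.RadicialJung.CleanModels

namespace KK05ValueBasis

/-- **Unramified ⇒ the maximal ideal downstairs extends to the maximal ideal upstairs** (Stacks 02FM / 00UW; Knaf–Kuhlmann 2005 §5 p. 12 via
[Ray] X Thm. 1): for `R → S` essentially of finite type and formally unramified and a prime `q` of `S`, `(q ∩ R) S_q = 𝔪_{S_q}`.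
[cite: KnafKuhlmann2005, Section 5 (p. 12)] -/
theorem map_under_eq_maximalIdeal_of_formallyUnramified {R S : Type*} [CommRing R] [CommRing S] [Algebra R S]
    [Algebra.EssFiniteType R S] [hRS : Algebra.FormallyUnramified R S] (q : Ideal S) [hq' : q.IsPrime] :
    (q.under R).map (algebraMap R (Localization.AtPrime q)) = maximalIdeal (Localization.AtPrime q) := by
  letI := Localization.AtPrime.algebraOfLiesOver (q.under R) q
  have hq : Algebra.IsUnramifiedAt R q :=
    ((Algebra.formallyUnramified_iff_forall (R := R) (A := S)).mp hRS) ⟨q, hq'⟩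
  exact ((Algebra.isUnramifiedAt_iff_map_eq R (q.under R) q).mp hq).2

/-- **Regular parameters ascend along an unramified extension**: if `R → S` is essentially of finite type and formally unramified, `q ⊂ S` is
prime and `q ∩ R = (a₁,…,a_n)`, then the maximal ideal of `S_q` is generated by the images of the `aᵢ` (so an r.s.p. of `R_{q ∩ R}` made of the `aᵢ`
stays an r.s.p. of `S_q` when the dimensions agree).  Used with `R = K[x', y][1/d]` (toric chart, centre `(x')`) and `S` the standard-étale model
of Knaf–Kuhlmann's Lemma 5.1. [cite: KnafKuhlmann2005, Section 5 (p. 12) and proof of Thm. 1.1 (p. 13)] -/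
theorem maximalIdeal_eq_span_of_formallyUnramified {R S : Type*} [CommRing R] [CommRing S] [Algebra R S]
    [Algebra.EssFiniteType R S] [Algebra.FormallyUnramified R S] (q : Ideal S) [q.IsPrime]
    {ι : Type*} (a : ι → R) (ha : Ideal.span (Set.range a) = q.under R) :
    maximalIdeal (Localization.AtPrime q) =
      Ideal.span (Set.range fun i => algebraMap R (Localization.AtPrime q) (a i)) := by
  rw [← map_under_eq_maximalIdeal_of_formallyUnramified (R := R) q, ← ha, Ideal.map_span, ← Set.range_comp]
  rfl

end KK05ValueBasis

end Summit.ResolutionOfSingularities.ResolutionOfSingularities.Theorems.RadicialJung.CleanModels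

end
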